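import Literature.Analysis.FluidPDE.ElgindiTangentialRegularity
import Literature.Analysis.FluidPDE.ElgindiThetaZeroEstimates
import Literature.Analysis.FluidPDE.ElgindiSliceBoundary
import Literature.Analysis.FluidPDE.ElgindiAngularDataBound
import Literature.Analysis.FluidPDE.ElgindiWordLocality
import HarnessLib

/-!
# The Lax–Milgram solution for smooth data generates a tangential family
([Elgindi2021] §7.1 Proposition 7.1, §7.3 Step 3)

Topic `Literature/Analysis/FluidPDE`. Support file (definitions with bodies and proved theorems, no
named facts) on the proof path of the named fact
`Literature.Analysis.FluidPDE.Elgindi.ElgindiGhoulMasmoudi2021_stabilityCore`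
(`ElgindiStabilityDecomposition.lean`). T. M. Elgindi, Ann. of Math. 194 (2021) =
arXiv:1904.04795, §7.1 Proposition 7.1 (p. 19), §7.3 proof of Proposition 7.7 Step 3 (p. 21).

For `0 < α ≤ 1` and a smooth datum `f` compactly supported inside `R > 0` and orthogonal to `K`,
let `U⁽ʲ⁾` be the weak solutions with data `D_R^jf` and `Ψ̃ ∈ C^∞(strip)` the smooth
representative of `U⁽⁰⁾₀`. Then `Ψ̃` is a `TangentialFamily α f Ψ̃` (`tangentialFamily`): the
commuted equations `L(D_R^kΨ̃) = D_R^kf` hold classically on the strip (`L` commutes with `D_R`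
on the strip, by localisation to compactly supported smooth functions), and the tangential and Hardy
energies of all `D_R^kΨ̃` are finite (energy space + the a.e. identifications of
`ElgindiTangentialRegularity.lean`).
-/

noncomputable section

open MeasureTheory Set Real Filter Function
open _root_.Topology
open scoped ENNReal InnerProductSpace ContDiff

namespace Literature.Analysis.FluidPDE

namespace Elgindi

/-! ### `L` commutes with `D_R^k` on functions smooth on the strip -/

/-- **`L(D_R^kΨ) = D_R^k(LΨ)` on the strip for `Ψ ∈ C^∞(strip)`.** [cite: Elgindi2021, §7.3 proof of Proposition 7.7, Step 3 (p. 21 of arXiv:1904.04795): "D_R commutes with the equation"] -/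
theorem ellipticOp_iterate_Dz_strip (α : ℝ) {Ψ : ℝ × ℝ → ℝ} (hΨ : ContDiffOn ℝ ∞ Ψ strip) (k : ℕ) {p : ℝ × ℝ} (hp : p ∈ strip) :
    ellipticOp α (Dz^[k] fun R θ => Ψ (R, θ)) p.1 p.2 = (Dz^[k] fun R θ => ellipticOp α (fun R' θ' => Ψ (R', θ')) R θ) p.1 p.2 := by
  obtain ⟨W, Ψt, hW, hpW, hWS, hΨt, -, -, hEq⟩ := exists_test_eqOn hΨ isCompact_singleton (singleton_subset_iff.2 hp)
  have hpW' : p ∈ W := hpW (mem_singleton p)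
  have hagree : ∀ q ∈ W, (fun R θ => Ψ (R, θ)) q.1 q.2 = (fun R θ => Ψt (R, θ)) q.1 q.2 := fun q hq => (hEq hq).symm
  -- left: localise `Dz^[k]Ψ` to `Dz^[k]Ψt` on `W`, then `L` is local
  have h1 := eqOn_ellipticOp α hW (iterate_Dz_congr_open (f := fun R θ => Ψ (R, θ)) (g := fun R θ => Ψt (R, θ)) hW hagree k) hpW'
  rw [h1]
  -- global commutation for the smooth compactly supported `Ψt`
  have hΨtc : ContDiff ℝ ((k + 3 : ℕ) : WithTop ℕ∞) (uncurry fun R θ => Ψt (R, θ)) := by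
    have := contDiff_infty.1 hΨt (k + 3); exact_mod_cast this
  rw [ellipticOp_iterate_Dz α k hΨtc p hp]
  -- right: `LΨt = LΨ` on `W` (locality of `L`), then iterate locality
  refine iterate_Dz_congr_open (f := fun R θ => ellipticOp α (fun R' θ' => Ψt (R', θ')) R θ)
    (g := fun R θ => ellipticOp α (fun R' θ' => Ψ (R', θ')) R θ) hW (fun q hq => ?_) k p hpW'
  exact eqOn_ellipticOp α hW (f := fun R θ => Ψt (R, θ)) (g := fun R θ => Ψ (R, θ)) (fun r hr => (hagree r hr).symm) hq

/-! ### The solution family -/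

section family

variable {α : ℝ} (hα : 0 < α) (hα1 : α ≤ 1) {f : ℝ → ℝ → ℝ} (hfn : ∀ n : ℕ, ContDiff ℝ n (uncurry f))
  (hfs : HasCompactSupport (uncurry f))
  (HF : ∀ n : ℝ → ℝ, Continuous n → HasCompactSupport n → ∫ p in strip, f p.1 p.2 * (n p.1 * kernelK p.2) = 0)
  {U : ℕ → E4} (hU : ∀ j, IsWeakSol α (toL2 fun p : ℝ × ℝ => (Dz^[j] f) p.1 p.2) (U j))
  {Ψ : ℝ × ℝ → ℝ} (hΨ : ContDiffOn ℝ ∞ Ψ strip)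
  (hae : ∀ᵐ y ∂(volume : Measure (ℝ × ℝ)), y ∈ strip → (U 0 0 : ℝ × ℝ → ℝ) y = Ψ y)

include hα hα1 hfn hfs HF hU hΨ hae

omit hα1 in
/-- The classical equation `LΨ̃ = f` on the strip. [folklore] -/
theorem ellipticOp_eq_datum : ∀ p ∈ strip, ellipticOp α (fun R θ => Ψ (R, θ)) p.1 p.2 = f p.1 p.2 := by
  have hfc : Continuous (uncurry f) := (hfn 0).continuous
  have hf' : ContDiffOn ℝ ∞ (uncurry f) strip := (contDiff_infty.2 hfn).contDiffOn
  have HF' : ∀ n : ℝ → ℝ, Continuous n → HasCompactSupport n → ∫ p in strip, uncurry f p * (n p.1 * kernelK p.2) = 0 := HF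
  have hU0 := hU 0
  have e0 : (toL2 fun p : ℝ × ℝ => (Dz^[0] f) p.1 p.2) = toL2 (uncurry f) := by congr 1
  rw [e0] at hU0
  have := ellipticOp_rep_eq hα hfc hfs hf' HF' hU0.mem hU0.eq hΨ hae
  exact fun p hp => this p hp

/-- **The smooth representative of the weak solution generates a tangential family.**
[cite: Elgindi2021, §7.1 Proposition 7.1 and §7.3 Step 3 (pp. 19, 21 of arXiv:1904.04795)] -/
theorem tangentialFamily : TangentialFamily α f (fun R θ => Ψ (R, θ)) := by
  refine ⟨?_, hfn, hfs, fun k p hp => ?_, fun k => ?_, fun k => ?_, fun k => ?_⟩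
  · have e : uncurry (fun R θ => Ψ (R, θ)) = Ψ := by funext q; rfl
    rw [e]; exact hΨ
  · -- `L(D_R^kΨ̃) = D_R^k(LΨ̃) = D_R^k f` on the strip
    rw [ellipticOp_iterate_Dz_strip α hΨ k hp]
    exact iterate_Dz_congr_open (f := fun R θ => ellipticOp α (fun R' θ' => Ψ (R', θ')) R θ) (g := f) isOpen_strip (ellipticOp_eq_datum hα hfn hfs HF hU hΨ hae) k p hp
  · exact (tangential_sq_integrable hα hα1 hfn hfs hU hΨ hae k).1
  · exact (tangential_sq_integrable hα hα1 hfn hfs hU hΨ hae k).2.1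
  · -- Hardy integrability from the energy space
    have hH := integrableOn_sq_div_sin_sq_weakSpace (hU k).mem
    refine hH.congr ?_
    filter_upwards [(ae_restrict_iff' measurableSet_strip).2 (weakSol_zero_ae_eq hα hα1 hfn hfs hU hΨ hae k)] with y hy
    rw [hy]

end family

end Elgindi

end Literature.Analysis.FluidPDE
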